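import Literature.Geometry.Lorentzian.KerrSchildKillingEnergy
import Literature.Geometry.Lorentzian.KerrSchildCoord
import Summits.FinalStateConjecture.FinalStateConjecture.Statement
import Summits.FinalStateConjecture.FinalStateConjecture.Theorems.ClusterCompletenessAdiabaticMultiKerrILEDField

/-!
# Crux `AdiabaticMultiKerrILED` (line `Sketch`) — the rest-frame tails-cut zone is stationary

Helper file for the crux `stmt-FinalStateConjecture-14310`
(`Summit.FinalStateConjecture.FinalStateConjecture.Theses.ClusterCompleteness.AdiabaticMultiKerrILED`),
line `Sketch`, stubs `multiplierBulk_timeField_tailsCut_eq_zero` (main),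
`fderiv_tailsCut_inverseMetric_basisVector_zero` and `cruxField_single_rest_eq` (lead c7, wave 1).

In its rest frame one zone of the crux's patched background is the generalised Kerr–Schild field
`G = η⁻¹ − φ ℓ♯ ⊗ ℓ♯ = KerrSchild.inverseMetric φ (Kerr.nullVector a)` with the TAILS-CUT
profile `φ(y) = χ(r(y)) · 2H(y)`, `χ(r) = Real.smoothTransition (2 − r/(8M))` (`χ = 1` for
`r ≤ 8M`: exact Kerr; `χ = 0` for `r ≥ 16M`: flat). This file proves:

* `tailsCut_profile_eq_of_radius_le` / `tailsCut_profile_eq_zero_of_le_radius` — the profile is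
  `2H` on `{r ≤ 8M}` and `0` on `{16M ≤ r}` (`M > 0`);
* `tailsCut_inverseMetric_add_smul_basisVector_zero` — **stationarity**: every ingredient
  (`r`, `H`, `ℓ♯`) is invariant under `x ↦ x + t ∂₀`, hence so is `G`;
* `contDiffAt_tailsCut_inverseMetric` — the components of `G` are `C^n` wherever `r > 0`;
* `fderiv_tailsCut_inverseMetric_basisVector_zero` — **`∂₀ G^{μν} = 0`** on `{r > 0}` (the
  line `t ↦ x + t ∂₀` is mapped to a constant, and `G^{μν}` is differentiable there);
* `multiplierBulk_timeField_tailsCut_eq_zero` — **`K^T = 0`**: the bulk term of the Killing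
  multiplier `T = ∂₀` (`KerrSchild.timeField`) vanishes on `{r > 0}`
  (`KerrSchild.multiplierBulk_of_fderiv_eq_zero`: `∂T = 0` leaves only
  `−½ T^μ ∂_μ G^{αβ} p_α p_β`, and `T^μ ∂_μ = ∂₀`);
* `cruxField_single_rest_eq` — for ONE hole at rest at the origin (`N = 1`, `Λ = 1`, `p = 0`,
  so `q = poincareInv 1 (0, 0⃗) = id` and `(1 : lorentzGroup) v = v`) the crux's coefficient
  field `η(e_μ, e_ν) − ∑_{i : Fin 1} χ · 2H · (Λℓ♯)^μ (Λℓ♯)^ν` IS this Kerr–Schild field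
  (`Kerr.minkowski_bilin_basisVector`: `η(e_μ, e_ν) = η_{μν}`).

Kerr–Schild 1965, §2 (stationarity of the Kerr–Schild form); Dafermos–Rodnianski–
Shlapentokh-Rothman arXiv:1402.7034, §2.2.2, §2.3.1 (`K^T = 0` for the Killing field `T`).
[folklore]
-/

noncomputable section

-- the doubled `FinalStateConjecture.FinalStateConjecture` path component trips dupNamespace
set_option linter.dupNamespace false

open scoped ContDiff Topology BigOperators
open Literature.Geometry.Lorentzian

namespace Summit.FinalStateConjecture.FinalStateConjecture.Theorems

/-! ### The tails-cut profile `χ(r) · 2H` -/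

/-- Inside `{r ≤ 8M}` (`M > 0`) the cut-off is `1`: the tails-cut profile is the exact Kerr
profile `2H`. [folklore] -/
theorem tailsCut_profile_eq_of_radius_le : ∀ (M a : ℝ) (x : E4), 0 < M →
    Kerr.radius a x ≤ 8 * M →
    Real.smoothTransition (2 - Kerr.radius a x / (8 * M)) * (2 * Kerr.scalarH M a x) =
      2 * Kerr.scalarH M a x := by
  intro M a x hM hr
  rw [cruxCutoff_eq_one hM hr, one_mul]

/-- Outside `{16M ≤ r}` (`M > 0`) the cut-off is `0`: the tails-cut profile vanishes (the zone is
flat there). [folklore] -/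
theorem tailsCut_profile_eq_zero_of_le_radius : ∀ (M a : ℝ) (x : E4), 0 < M →
    16 * M ≤ Kerr.radius a x →
    Real.smoothTransition (2 - Kerr.radius a x / (8 * M)) * (2 * Kerr.scalarH M a x) = 0 := by
  intro M a x hM hr
  rw [cruxCutoff_eq_zero hM hr, zero_mul]

/-! ### Stationarity of the rest-frame tails-cut field -/

/-- **Stationarity of the tails-cut Kerr–Schild field**: `G^{μν}(x + t ∂₀) = G^{μν}(x)` — the
radius `r`, the scalar `H` and the null vector `ℓ♯` do not depend on `x⁰`
(`Kerr.radius_add_time_smul_basisVector`, `Kerr.scalarH_add_smul_basisVector_zero`,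
`Kerr.nullVector_add_smul_basisVector_zero`). Kerr–Schild 1965, §2. [folklore] -/
theorem tailsCut_inverseMetric_add_smul_basisVector_zero : ∀ (M a : ℝ) (x : E4) (t : ℝ)
    (μ ν : Fin 4),
    KerrSchild.inverseMetric
        (fun y ↦ Real.smoothTransition (2 - Kerr.radius a y / (8 * M)) * (2 * Kerr.scalarH M a y))
        (Kerr.nullVector a) (x + t • E4.basisVector 0) μ ν =
      KerrSchild.inverseMetric
        (fun y ↦ Real.smoothTransition (2 - Kerr.radius a y / (8 * M)) * (2 * Kerr.scalarH M a y))
        (Kerr.nullVector a) x μ ν := by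
  intro M a x t μ ν
  simp only [KerrSchild.inverseMetric, Kerr.radius_add_time_smul_basisVector,
    Kerr.scalarH_add_smul_basisVector_zero, Kerr.nullVector_add_smul_basisVector_zero]

/-- The components of the tails-cut Kerr–Schild field are `C^n` wherever `r > 0` (`r`, `H`, `ℓ♯`
are real-analytic off the ring, `Real.smoothTransition` is smooth). [folklore] -/
theorem contDiffAt_tailsCut_inverseMetric (M a : ℝ) {x : E4} (hx : 0 < Kerr.radius a x)
    (μ ν : Fin 4) {n : ℕ∞} :
    ContDiffAt ℝ n (fun y ↦ KerrSchild.inverseMetric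
      (fun z ↦ Real.smoothTransition (2 - Kerr.radius a z / (8 * M)) * (2 * Kerr.scalarH M a z))
      (Kerr.nullVector a) y μ ν) x := by
  have hV : ∀ κ, ContDiffAt ℝ (n : WithTop ℕ∞) (fun y ↦ Kerr.nullVector a y κ) x :=
    fun κ ↦ contDiffAt_euclidean.mp (Kerr.contDiffAt_nullVector a hx) κ
  have hr : ContDiffAt ℝ (n : WithTop ℕ∞) (fun y ↦ 2 - Kerr.radius a y / (8 * M)) x :=
    contDiffAt_const.sub ((Kerr.contDiffAt_radius hx).div_const _)
  have hχ : ContDiffAt ℝ (n : WithTop ℕ∞)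
      (fun y ↦ Real.smoothTransition (2 - Kerr.radius a y / (8 * M))) x :=
    Real.smoothTransition.contDiff.contDiffAt.comp x hr
  have hH : ContDiffAt ℝ (n : WithTop ℕ∞) (Kerr.scalarH M a) x := Kerr.contDiffAt_scalarH M a hx
  unfold KerrSchild.inverseMetric
  exact contDiffAt_const.sub (((hχ.mul (contDiffAt_const.mul hH)).mul (hV μ)).mul (hV ν))

/-- **`∂₀ G^{μν} = 0` for the tails-cut Kerr–Schild field** on `{r > 0}`: the component is
differentiable there and constant along the line `t ↦ x + t ∂₀`, so its derivative in the
direction `∂₀` vanishes (uniqueness of the line derivative). Kerr–Schild 1965, §2. [folklore] -/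
theorem fderiv_tailsCut_inverseMetric_basisVector_zero : ∀ (M a : ℝ) (x : E4) (μ ν : Fin 4),
    0 < Kerr.radius a x →
    fderiv ℝ (fun y ↦ KerrSchild.inverseMetric
        (fun z ↦ Real.smoothTransition (2 - Kerr.radius a z / (8 * M)) * (2 * Kerr.scalarH M a z))
        (Kerr.nullVector a) y μ ν) x (E4.basisVector 0) = 0 := by
  intro M a x μ ν hx
  set g : E4 → ℝ := fun y ↦ KerrSchild.inverseMetric
    (fun z ↦ Real.smoothTransition (2 - Kerr.radius a z / (8 * M)) * (2 * Kerr.scalarH M a z))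
    (Kerr.nullVector a) y μ ν with hg
  have hd : DifferentiableAt ℝ g x :=
    (contDiffAt_tailsCut_inverseMetric M a hx μ ν (n := 1)).differentiableAt one_ne_zero
  have h1 : HasDerivAt (fun t : ℝ ↦ g (x + t • E4.basisVector 0))
      (fderiv ℝ g x (E4.basisVector 0)) 0 :=
    hd.hasFDerivAt.hasLineDerivAt (E4.basisVector 0)
  have hconst : (fun t : ℝ ↦ g (x + t • E4.basisVector 0)) = fun _ ↦ g x :=
    funext fun t ↦ tailsCut_inverseMetric_add_smul_basisVector_zero M a x t μ ν
  rw [hconst] at h1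
  exact h1.unique (hasDerivAt_const 0 (g x))

/-- **`K^T = 0` on the rest-frame tails-cut zone**: the bulk term of the multiplier `T = ∂₀`
(`KerrSchild.timeField`, constant components) for the tails-cut Kerr–Schild field vanishes
wherever `r > 0` — `∂T = 0` kills the first two groups of `KerrSchild.multiplierBulk`
(`KerrSchild.multiplierBulk_of_fderiv_eq_zero`) and `T^μ ∂_μ G^{αβ} = ∂₀ G^{αβ} = 0` by
stationarity. DRSR arXiv:1402.7034, §2.2.2, §2.3.1 (`T` is Killing). [folklore] -/
theorem multiplierBulk_timeField_tailsCut_eq_zero : ∀ (M a : ℝ) (w : E4 → ℝ) (x : E4),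
    0 < Kerr.radius a x →
    KerrSchild.multiplierBulk
        (KerrSchild.inverseMetric
          (fun y ↦ Real.smoothTransition (2 - Kerr.radius a y / (8 * M)) * (2 * Kerr.scalarH M a y))
          (Kerr.nullVector a))
        KerrSchild.timeField w x = 0 := by
  intro M a w x hx
  rw [KerrSchild.multiplierBulk_of_fderiv_eq_zero _ w (fun α ↦ KerrSchild.fderiv_timeField α x)]
  simp [Fin.sum_univ_succ, fderiv_tailsCut_inverseMetric_basisVector_zero M a x _ _ hx]

/-! ### One hole at rest: the crux field is the tails-cut Kerr–Schild field -/

/-- `(0, 0⃗) = 0` in `E4`. [folklore] -/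
private theorem ofTimeSpace_zero_zero : E4.ofTimeSpace 0 (0 : E3) = 0 := by
  ext i
  refine Fin.cases ?_ (fun j ↦ ?_) i <;> simp

/-- The trivial motion based at the origin is the identity: `poincareInv 1 (0, 0⃗) x = x`
(O'Neill 1983, Ch. 9, p. 236). [folklore] -/
private theorem poincareInv_one_ofTimeSpace_zero (x : E4) :
    poincareInv (1 : lorentzGroup) (E4.ofTimeSpace 0 (0 : E3)) x = x := by
  rw [ofTimeSpace_zero_zero, poincareInv, sub_zero]
  rfl

/-- **The crux field of one hole at rest at the origin is the tails-cut Kerr–Schild field.**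
With `N = 1`, `Λ = 1`, `p = 0` the crux hypothesis reads
`G^{μν}(x) = η(e_μ, e_ν) − χ(r(x)) · 2H(x) · ℓ♯(x)^μ ℓ♯(x)^ν` (`poincareInv 1 (0, 0⃗) = id`,
`(1 : lorentzGroup) v = v`, the sum over `Fin 1` is its single term), and
`η(e_μ, e_ν) = η_{μν} = Kerr.etaComp μ ν` (`Kerr.minkowski_bilin_basisVector`), which is
`KerrSchild.inverseMetric (χ · 2H) ℓ♯` unfolded. [folklore] -/
theorem cruxField_single_rest_eq : ∀ (M a : ℝ) (G : E4 → Fin 4 → Fin 4 → ℝ),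
    (∀ x μ ν, G x μ ν = Minkowski.bilin (E4.basisVector μ) (E4.basisVector ν) -
      ∑ i : Fin 1, Real.smoothTransition (2 - Kerr.radius ((fun _ ↦ a) i)
          ((fun _ ↦ poincareInv (1 : lorentzGroup) (E4.ofTimeSpace 0 (0 : E3))) i x) /
            (8 * (fun _ ↦ M) i)) *
        (2 * Kerr.scalarH ((fun _ ↦ M) i) ((fun _ ↦ a) i)
          ((fun _ ↦ poincareInv (1 : lorentzGroup) (E4.ofTimeSpace 0 (0 : E3))) i x)) *
        (((fun _ ↦ (1 : lorentzGroup)) i : E4 ≃L[ℝ] E4)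
          (Kerr.nullVector ((fun _ ↦ a) i)
            ((fun _ ↦ poincareInv (1 : lorentzGroup) (E4.ofTimeSpace 0 (0 : E3))) i x))) μ *
        (((fun _ ↦ (1 : lorentzGroup)) i : E4 ≃L[ℝ] E4)
          (Kerr.nullVector ((fun _ ↦ a) i)
            ((fun _ ↦ poincareInv (1 : lorentzGroup) (E4.ofTimeSpace 0 (0 : E3))) i x))) ν) →
    ∀ x μ ν, G x μ ν = KerrSchild.inverseMetric
        (fun y ↦ Real.smoothTransition (2 - Kerr.radius a y / (8 * M)) * (2 * Kerr.scalarH M a y))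
        (Kerr.nullVector a) x μ ν := by
  intro M a G hG x μ ν
  have h1 : ∀ v : E4, ((1 : lorentzGroup) : E4 ≃L[ℝ] E4) v = v := fun _ ↦ rfl
  rw [hG x μ ν]
  simp only [Finset.univ_unique, Fin.default_eq_zero, Finset.sum_singleton,
    poincareInv_one_ofTimeSpace_zero, h1, KerrSchild.inverseMetric,
    Kerr.minkowski_bilin_basisVector]

end Summit.FinalStateConjecture.FinalStateConjecture.Theorems

end
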